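import Mathlib
import Literature.NumberTheory.Automorphic.CuspidalSubspace
import Literature.NumberTheory.Automorphic.AutomorphicKernelOperatorsCommute

/-!
# Cusp means at all cusps and the cuspidal subspace of `L²(Γ\ℍ)` for a general Fuchsian group
(Iwaniec, *Spectral Methods of Automorphic Forms*, GSM 53, §3.2 (3.2)–(3.4) (Fourier expansion at a
cusp `𝔞` through the scaling matrix `σ_𝔞`), §3.3 (3.15) (the space `𝓒(Γ\ℍ)` of automorphic functions
whose zero-th Fourier coefficients vanish at every cusp) and §4.2 (the Proposition on p. 49: invariant
integral operators preserve `𝓒(Γ\ℍ)`); PDF pp. 41–44, 49)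

First layer of the *discrete spectrum for a general finite volume group* (generalising the
`SL₂(ℤ)` files `CuspidalSubspace` / `CuspFormsCompact` / `MaassCuspForms` behind
`Iwaniec2002_thm_7_4_modular` to the setting of `Iwaniec2002_thm_7_4`): a discrete `Γ ≤ SL₂(ℝ)` with
`-1 ∈ Γ`, a measurable fundamental domain `F`, and scaling matrices `σ_i ∈ SL₂(ℝ)` of its cusps
(`FuchsianCuspZones.exists_cuspSystem`). Everything here is proved; nothing is vendored.

1. (§1) **The cusp mean at the cusp `𝔞 = σ∞`**: `cuspMeanAt σ G w = ∫_0^1 G(σ(w + ξ)) dξ`, the zero-th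
   Fourier coefficient of `G ∘ σ` ((3.2)–(3.4)); composition with `σ` preserves measurability,
   local integrability and a.e. equality (the hyperbolic measure is `SL₂(ℝ)`-invariant), and
   **`(L_k G)_𝔞 = L_k(G_𝔞)`** (`cuspMeanAt_invariantOperator`: `L_k` commutes with `σ` and with the
   horocyclic average, `cuspMean_invariantOperator`).
2. (§2) **The cuspidal subspace** `cuspSubmodule hΓ hneg hd hF σ ⊆ L²(F)`: the classes `g` whose
   automorphic extension `g^Γ = autExt Γ F g` has vanishing cusp mean at every cusp `σ_i ∞`, a.e. —
   the closure in `L²` of Iwaniec's `𝓒(Γ\ℍ)` (3.15) realised inside `L²(F)`.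
3. (§3) **It is closed** (`isClosed_cuspSubmodule`): the cusp-mean maps `g ↦ (g^Γ)_𝔞` are continuous
   from `L²(F)` to `L¹_loc(ℍ)` (`lintegral_enorm_cuspMeanAt_autExt_le`, the local `L²` bound of
   `autExt` moved to the ball `B(σz₀, D')`).
4. (§4) **It is invariant under the operators `T_k`** of `AutomorphicKernelOperators`
   (`kernelCLM_mem_cuspSubmodule`; Iwaniec §4.2), and `cuspKernelCLM`, the restriction
   `T_k|_𝓒 : 𝓒 →L[ℂ] 𝓒`.

## References
* [Iwaniec2002] H. Iwaniec, *Spectral Methods of Automorphic Forms*, 2nd ed., GSM 53, AMS 2002,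
  §3.2–3.3, §4.2, PDF pp. 41–44, 49.

Mathlib: `MeasureTheory.measurePreserving_smul` (`SMulInvariantMeasure (GL (Fin 2) ℝ) ℍ volume`),
`MeasurePreserving.setLIntegral_comp_preimage_emb`, `IsometryEquiv.image_closedBall`,
`Submodule`, `ContinuousLinearMap.codRestrict`. Literature: `cuspMean`, `cuspMean_invariantOperator`,
`cuspMean_congr_ae`, `cuspMean_add`, `cuspMean_const_mul`, `lintegral_enorm_cuspMean_le`,
`lintegral_enorm_le_sqrt_mul`, `ae_intervalIntegrable_comp_vadd`, `aestronglyMeasurable_cuspMean`,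
`isAutomorphic_kernelOp`, `invariantOperator_of_ae_eq_zero` (`CuspidalSubspace`); `autExt`,
`autExt_congr_ae`, `autExt_add_ae`, `autExt_const_mul`, `autExt_ae_eq_of_isAutomorphic`,
`aestronglyMeasurable_autExt`, `locallyIntegrable_autExt`, `lintegral_enorm_sq_autExt_le`,
`tsum_indicator_dist_le_lt_top`, `kernelCLM`, `kernelCLM_coeFn`, `kernelOp_eq_invariantOperator`
(`AutomorphicKernelOperators`); `invariantOperator_comp_smul` (`InvariantIntegralOperators`).
-/

noncomputable section

open MeasureTheory Set Filter Real UpperHalfPlane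
open scoped Topology MatrixGroups ComplexConjugate NNReal ENNReal Pointwise

namespace Literature.NumberTheory.Automorphic

namespace Fuchsian

/-! ## 1. Cusp means at a cusp `𝔞 = σ ∞` -/

section CuspMeanAt

variable {k : ℝ → ℝ}

/-- **The cusp mean at the cusp `𝔞 = σ∞`**: `G_𝔞(w) = ∫_0^1 G(σ(w + ξ)) dξ`, the zero-th Fourier
coefficient of `G ∘ σ` at height `Im w`. [cite: Iwaniec2002, §3.2 (3.2)–(3.4), PDF pp. 41–42] -/
def cuspMeanAt (s : SL(2, ℝ)) (G : ℍ → ℂ) (w : ℍ) : ℂ := cuspMean (fun v => G (s • v)) w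

/-- Unfolding lemma. [cite: Iwaniec2002, §3.2 (3.2), PDF p. 41] -/
theorem cuspMeanAt_apply (s : SL(2, ℝ)) (G : ℍ → ℂ) (w : ℍ) :
    cuspMeanAt s G w = ∫ ξ in (0 : ℝ)..1, G (s • (ξ +ᵥ w)) := rfl

/-- At the cusp `∞` with `σ = 1` this is the cusp mean. [folklore] -/
theorem cuspMeanAt_one (G : ℍ → ℂ) : cuspMeanAt 1 G = cuspMean G := by
  funext w
  simp [cuspMeanAt, cuspMean]

/-- The action of `s ∈ SL₂(ℝ)` preserves the hyperbolic measure. [cite: Iwaniec2002, (1.8), PDF p. 10] -/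
theorem measurePreserving_sl_smul (s : SL(2, ℝ)) :
    MeasurePreserving (fun v : ℍ => s • v) (volume : Measure ℍ) volume :=
  measurePreserving_smul (Matrix.SpecialLinearGroup.toGL s : GL (Fin 2) ℝ) (volume : Measure ℍ)

/-- Composition with `s` preserves a.e.-strong measurability. [folklore] -/
theorem aestronglyMeasurable_comp_sl_smul {G : ℍ → ℂ} (hG : AEStronglyMeasurable G volume) (s : SL(2, ℝ)) :
    AEStronglyMeasurable (fun v : ℍ => G (s • v)) volume :=
  hG.comp_quasiMeasurePreserving (measurePreserving_sl_smul s).quasiMeasurePreserving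

/-- Composition with `s` preserves local integrability. [folklore] -/
theorem locallyIntegrable_comp_sl_smul {G : ℍ → ℂ} (hG : LocallyIntegrable G) (s : SL(2, ℝ)) :
    LocallyIntegrable (fun v : ℍ => G (s • v)) := by
  rw [locallyIntegrable_iff]
  intro C hC
  have hme : MeasurableEmbedding (fun v : ℍ => s • v) :=
    (Homeomorph.smul s).isClosedEmbedding.measurableEmbedding
  have h1 : IntegrableOn G ((fun v : ℍ => s • v) '' C) := hG.integrableOn_isCompact (hC.image (continuous_const_smul s))
  have h2 := ((measurePreserving_sl_smul s).integrableOn_comp_preimage hme).mpr h1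
  rwa [Set.preimage_image_eq _ (MulAction.injective s)] at h2

/-- Composition with `s` preserves a.e. equality. [folklore] -/
theorem ae_eq_comp_sl_smul {G G' : ℍ → ℂ} (hGG' : G =ᵐ[volume] G') (s : SL(2, ℝ)) :
    (fun v : ℍ => G (s • v)) =ᵐ[volume] fun v => G' (s • v) :=
  (measurePreserving_sl_smul s).quasiMeasurePreserving.ae_eq_comp hGG'

/-- A.e. equal functions have a.e. equal cusp means at every cusp. [folklore] -/
theorem cuspMeanAt_congr_ae {G G' : ℍ → ℂ} (hGG' : G =ᵐ[volume] G') (s : SL(2, ℝ)) :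
    cuspMeanAt s G =ᵐ[volume] cuspMeanAt s G' :=
  cuspMean_congr_ae (ae_eq_comp_sl_smul hGG' s)

/-- Additivity of the cusp mean at a point where both horocyclic integrals exist. [folklore] -/
theorem cuspMeanAt_add {s : SL(2, ℝ)} {f g : ℍ → ℂ} {w : ℍ}
    (hf : IntervalIntegrable (fun ξ : ℝ => f (s • (ξ +ᵥ w))) volume 0 1)
    (hg : IntervalIntegrable (fun ξ : ℝ => g (s • (ξ +ᵥ w))) volume 0 1) :
    cuspMeanAt s (fun z => f z + g z) w = cuspMeanAt s f w + cuspMeanAt s g w :=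
  cuspMean_add hf hg

/-- Homogeneity of the cusp mean. [folklore] -/
theorem cuspMeanAt_const_mul (s : SL(2, ℝ)) (c : ℂ) (f : ℍ → ℂ) (w : ℍ) :
    cuspMeanAt s (fun z => c * f z) w = c * cuspMeanAt s f w :=
  cuspMean_const_mul c _ w

/-- The cusp mean of an a.e. vanishing function vanishes a.e. [folklore] -/
theorem cuspMeanAt_zero (s : SL(2, ℝ)) : cuspMeanAt s (fun _ : ℍ => (0 : ℂ)) = fun _ => 0 := by
  funext w
  simp [cuspMeanAt, cuspMean]

/-- **The cusp means commute with the invariant integral operators**: `(L_k G)_𝔞 = L_k (G_𝔞)`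
(`L_k` commutes with `σ` and with the horocyclic average). [cite: Iwaniec2002, §4.2 (Prop. p. 49, proof) & (3.13), PDF pp. 43, 49] -/
theorem cuspMeanAt_invariantOperator (hk : IsTestKernel k) {G : ℍ → ℂ} (hG : LocallyIntegrable G)
    (s : SL(2, ℝ)) (w : ℍ) :
    cuspMeanAt s (invariantOperator k G) w = invariantOperator k (cuspMeanAt s G) w := by
  have e : (fun v : ℍ => invariantOperator k G (s • v)) = invariantOperator k (fun v : ℍ => G (s • v)) :=
    funext fun v => (invariantOperator_comp_smul k G s v).symm
  unfold cuspMeanAt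
  rw [show cuspMean (fun v : ℍ => invariantOperator k G (s • v)) w =
      cuspMean (invariantOperator k (fun v : ℍ => G (s • v))) w by rw [e]]
  exact cuspMean_invariantOperator hk (locallyIntegrable_comp_sl_smul hG s) w

/-- The horocyclic integrals of a locally integrable `G ∘ σ` exist at a.e. point. [folklore] -/
theorem ae_intervalIntegrable_comp_sl_smul_vadd {G : ℍ → ℂ} (hG : LocallyIntegrable G) (s : SL(2, ℝ)) :
    ∀ᵐ w : ℍ, IntervalIntegrable (fun ξ : ℝ => G (s • (ξ +ᵥ w))) volume 0 1 := by
  filter_upwards [ae_intervalIntegrable_comp_vadd (locallyIntegrable_comp_sl_smul hG s)] with w hw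
  exact hw

end CuspMeanAt

/-! ## 2. The cuspidal subspace -/

section Cuspidal

variable {Γ : Subgroup (GL (Fin 2) ℝ)} {F : Set ℍ}
variable (hΓ : Γ ≤ (Matrix.SpecialLinearGroup.toGL : SL(2, ℝ) →* GL (Fin 2) ℝ).range)
  (hneg : (-1 : GL (Fin 2) ℝ) ∈ Γ) (hd : IsDiscreteSubgroup Γ) (hF : IsHypFundamentalDomain Γ F)
  {h : ℕ} (σ : Fin h → SL(2, ℝ))

include hΓ hneg hd hF in
/-- **The cuspidal subspace** `𝓒 ⊆ L²(F)` of a Fuchsian group with scaling matrices `σ_i` of its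
cusps: the classes `g` whose automorphic extension `g^Γ` has vanishing cusp mean
`(g^Γ)_{𝔞_i}(w) = ∫_0^1 g^Γ(σ_i(w + ξ)) dξ = 0` for a.e. `w`, at every cusp — the closure in `L²` of
Iwaniec's space `𝓒(Γ\ℍ)` of automorphic functions whose zero-th Fourier coefficients vanish at
all cusps ((3.15)), realised inside `L²(F)`. [cite: Iwaniec2002, §3.3 (3.15), PDF p. 44] -/
def cuspSubmodule : Submodule ℂ (Lp ℂ 2 ((volume : Measure ℍ).restrict F)) where
  carrier := {g | ∀ i, cuspMeanAt (σ i) (autExt Γ F g) =ᵐ[volume] 0}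
  zero_mem' := by
    intro i
    have h0 : autExt Γ F (⇑(0 : Lp ℂ 2 ((volume : Measure ℍ).restrict F))) =ᵐ[volume]
        autExt Γ F (fun _ => (0 : ℂ)) :=
      autExt_congr_ae hΓ hneg hd hF (Lp.coeFn_zero ℂ 2 _)
    have h1 : autExt Γ F (fun _ => (0 : ℂ)) = fun _ => 0 := by
      funext z; simp [autExt]
    rw [h1] at h0
    refine (cuspMeanAt_congr_ae h0 (σ i)).trans (Eventually.of_forall fun w => ?_)
    rw [cuspMeanAt_zero]
    rfl
  add_mem' := by
    intro f g hf hg i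
    have h1 : autExt Γ F (⇑(f + g)) =ᵐ[volume] autExt Γ F (fun z => f z + g z) :=
      autExt_congr_ae hΓ hneg hd hF (Lp.coeFn_add f g)
    have h2 := autExt_add_ae hΓ hneg hd hF (⇑f) (⇑g)
    have h3 := cuspMeanAt_congr_ae (h1.trans h2) (σ i)
    have hfi := ae_intervalIntegrable_comp_sl_smul_vadd (locallyIntegrable_autExt hΓ hneg hd hF (Lp.memLp f)) (σ i)
    have hgi := ae_intervalIntegrable_comp_sl_smul_vadd (locallyIntegrable_autExt hΓ hneg hd hF (Lp.memLp g)) (σ i)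
    filter_upwards [h3, hfi, hgi, hf i, hg i] with w hw hfw hgw hf0 hg0
    rw [hw, cuspMeanAt_add hfw hgw, hf0, hg0]
    simp
  smul_mem' := by
    intro c g hg i
    have h1 : autExt Γ F (⇑(c • g)) =ᵐ[volume] autExt Γ F (fun z => c * g z) :=
      autExt_congr_ae hΓ hneg hd hF (Lp.coeFn_smul c g)
    have h2 : autExt Γ F (fun z => c * g z) = fun z => c * autExt Γ F g z := by
      funext z; exact autExt_const_mul c g z
    rw [h2] at h1
    filter_upwards [cuspMeanAt_congr_ae h1 (σ i), hg i] with w hw hg0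
    rw [hw, cuspMeanAt_const_mul, hg0]
    simp

/-- Membership unfolding. [folklore] -/
theorem mem_cuspSubmodule_iff (g : Lp ℂ 2 ((volume : Measure ℍ).restrict F)) :
    g ∈ cuspSubmodule hΓ hneg hd hF σ ↔ ∀ i, cuspMeanAt (σ i) (autExt Γ F g) =ᵐ[volume] 0 := Iff.rfl

end Cuspidal

/-! ## 3. The cuspidal subspace is closed -/

section Closed

variable {Γ : Subgroup (GL (Fin 2) ℝ)} {F : Set ℍ}
variable (hΓ : Γ ≤ (Matrix.SpecialLinearGroup.toGL : SL(2, ℝ) →* GL (Fin 2) ℝ).range)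
  (hneg : (-1 : GL (Fin 2) ℝ) ∈ Γ) (hd : IsDiscreteSubgroup Γ) (hF : IsHypFundamentalDomain Γ F)

/-- Moving a ball by `s`: `∫_{B(z₀,D)} Φ(s v) dμ(v) = ∫_{B(s z₀, D)} Φ dμ`. [cite: Iwaniec2002, (1.8), PDF p. 10] -/
theorem setLIntegral_closedBall_comp_sl_smul (s : SL(2, ℝ)) (Φ : ℍ → ℝ≥0∞) (z₀ : ℍ) (D : ℝ) :
    ∫⁻ v in Metric.closedBall z₀ D, Φ (s • v) = ∫⁻ w in Metric.closedBall (s • z₀) D, Φ w := by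
  have hme : MeasurableEmbedding (fun v : ℍ => s • v) :=
    (Homeomorph.smul s).isClosedEmbedding.measurableEmbedding
  have e1 : Metric.closedBall (s • z₀) D = (fun v : ℍ => s • v) '' Metric.closedBall z₀ D :=
    ((IsometryEquiv.constSMul s).image_closedBall z₀ D).symm
  have e2 : (fun v : ℍ => s • v) ⁻¹' Metric.closedBall (s • z₀) D = Metric.closedBall z₀ D := by
    rw [e1, Set.preimage_image_eq _ (MulAction.injective s)]
  rw [← e2]
  exact (measurePreserving_sl_smul s).setLIntegral_comp_preimage_emb hme Φ _

include hΓ hneg hd hF in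
/-- **Continuity estimate for the cusp-mean maps `g ↦ (g^Γ)_𝔞`** from `L²(F)` to `L¹_loc(ℍ)`:
`∫_{B(z₀,D)} |(g^Γ)_𝔞| dμ ≤ K · (∫_F |g|²)^{1/2}` with `K` depending only on the ball and the cusp.
[folklore] -/
theorem lintegral_enorm_cuspMeanAt_autExt_le (s : SL(2, ℝ)) (z₀ : ℍ) (D : ℝ) :
    ∃ K : ℝ≥0∞, K ≠ ∞ ∧ ∀ g : ℍ → ℂ, AEStronglyMeasurable g (volume.restrict F) →
      ∫⁻ w in Metric.closedBall z₀ D, ‖cuspMeanAt s (autExt Γ F g) w‖ₑ ≤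
        K * (∫⁻ w in F, ‖g w‖ₑ ^ 2) ^ (1 / 2 : ℝ) := by
  set D' : ℝ := D + Real.exp D / z₀.im with hD'
  set C' : Set ℍ := Metric.closedBall (s • z₀) D' with hC'
  set N : ℝ≥0∞ := ∑' δ : Γ, {δ : Γ | dist ((δ : GL (Fin 2) ℝ) • (s • z₀)) (s • z₀) ≤ 2 * D'}.indicator
    (fun _ => (1 : ℝ≥0∞)) δ with hN
  have hNfin : N ≠ ∞ := (tsum_indicator_dist_le_lt_top hΓ hd (s • z₀) (2 * D')).ne
  refine ⟨(volume C') ^ (1 / 2 : ℝ) * N ^ (1 / 2 : ℝ), ?_, fun g hg => ?_⟩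
  · exact ENNReal.mul_ne_top (ENNReal.rpow_ne_top_of_nonneg (by norm_num)
      (isCompact_closedBall _ _).measure_lt_top.ne) (ENNReal.rpow_ne_top_of_nonneg (by norm_num) hNfin)
  have hGm : AEStronglyMeasurable (autExt Γ F g) volume := aestronglyMeasurable_autExt hΓ hneg hd hF hg
  have hGsm : AEStronglyMeasurable (fun v : ℍ => autExt Γ F g (s • v)) volume := aestronglyMeasurable_comp_sl_smul hGm s
  have h1 := lintegral_enorm_cuspMean_le hGsm z₀ D
  have h1' : ∫⁻ w in Metric.closedBall z₀ D', ‖autExt Γ F g (s • w)‖ₑ = ∫⁻ w in C', ‖autExt Γ F g w‖ₑ :=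
    setLIntegral_closedBall_comp_sl_smul s (fun w => ‖autExt Γ F g w‖ₑ) z₀ D'
  have h2 := lintegral_enorm_le_sqrt_mul (S := C') hGm
  have h3 := lintegral_enorm_sq_autExt_le hΓ hneg hd hF measurableSet_closedBall (subset_refl C') hg
  have h4 : ∫⁻ w in C', ‖autExt Γ F g w‖ₑ ^ 2 ≤ N * ∫⁻ w in F, ‖g w‖ₑ ^ 2 := by
    refine le_trans ?_ h3
    conv_lhs => rw [← one_mul (∫⁻ w in C', ‖autExt Γ F g w‖ₑ ^ 2)]
    gcongr
    norm_num
  calc ∫⁻ w in Metric.closedBall z₀ D, ‖cuspMeanAt s (autExt Γ F g) w‖ₑ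
      ≤ ∫⁻ w in Metric.closedBall z₀ D', ‖autExt Γ F g (s • w)‖ₑ := h1
    _ = ∫⁻ w in C', ‖autExt Γ F g w‖ₑ := h1'
    _ ≤ (volume C') ^ (1 / 2 : ℝ) * (∫⁻ w in C', ‖autExt Γ F g w‖ₑ ^ 2) ^ (1 / 2 : ℝ) := h2
    _ ≤ (volume C') ^ (1 / 2 : ℝ) * (N * ∫⁻ w in F, ‖g w‖ₑ ^ 2) ^ (1 / 2 : ℝ) := by gcongr
    _ = (volume C') ^ (1 / 2 : ℝ) * N ^ (1 / 2 : ℝ) * (∫⁻ w in F, ‖g w‖ₑ ^ 2) ^ (1 / 2 : ℝ) := by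
        rw [ENNReal.mul_rpow_of_nonneg _ _ (by norm_num), mul_assoc]

/-- The `L²(F)` norm as a Lebesgue integral: `(∫_F |g|²)^{1/2} = ‖g‖`. [folklore] -/
theorem lintegral_rpow_eq_enorm' (g : Lp ℂ 2 ((volume : Measure ℍ).restrict F)) :
    (∫⁻ w in F, ‖g w‖ₑ ^ 2) ^ (1 / 2 : ℝ) = ‖g‖ₑ := by
  rw [Lp.enorm_def, eLpNorm_eq_lintegral_rpow_enorm_toReal (by norm_num) ENNReal.ofNat_ne_top]
  simp only [ENNReal.toReal_ofNat, one_div]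
  congr 1
  refine lintegral_congr fun w => ?_
  rw [← ENNReal.rpow_natCast]; norm_num

include hΓ hneg hd hF in
/-- **The cuspidal subspace is closed in `L²(F)`** (each cusp-mean map is continuous into `L¹_loc`;
Iwaniec works with the closure `𝓒̃(Γ\ℍ)` directly, §3.3). [cite: Iwaniec2002, §3.3, PDF p. 44] -/
theorem isClosed_cuspSubmodule {h : ℕ} (σ : Fin h → SL(2, ℝ)) :
    IsClosed (cuspSubmodule hΓ hneg hd hF σ : Set (Lp ℂ 2 ((volume : Measure ℍ).restrict F))) := by
  refine IsSeqClosed.isClosed fun u g hu hug => ?_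
  rw [SetLike.mem_coe, mem_cuspSubmodule_iff]
  intro i
  -- it suffices to prove vanishing a.e. on every ball `B(i, n)`
  suffices hball : ∀ n : ℕ, ∀ᵐ w : ℍ, w ∈ Metric.closedBall UpperHalfPlane.I n →
      cuspMeanAt (σ i) (autExt Γ F g) w = 0 by
    rw [← ae_all_iff] at hball
    filter_upwards [hball] with w hw
    obtain ⟨n, hn⟩ := exists_nat_ge (dist w UpperHalfPlane.I)
    exact hw n (Metric.mem_closedBall.mpr hn)
  intro n
  obtain ⟨K, hK, hest⟩ := lintegral_enorm_cuspMeanAt_autExt_le hΓ hneg hd hF (σ i) UpperHalfPlane.I n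
  set Φ : ℍ → ℂ := cuspMeanAt (σ i) (autExt Γ F g) with hΦ
  have hΦm : AEStronglyMeasurable Φ volume :=
    aestronglyMeasurable_cuspMean (aestronglyMeasurable_comp_sl_smul
      (aestronglyMeasurable_autExt hΓ hneg hd hF (Lp.memLp g).1) (σ i))
  -- the `L¹` mass of `Φ` on the ball is bounded by `K ‖g - u m‖` for every `m`
  have hbound : ∀ m : ℕ, ∫⁻ w in Metric.closedBall UpperHalfPlane.I n, ‖Φ w‖ₑ ≤ K * ‖g - u m‖ₑ := by
    intro m
    have hum : cuspMeanAt (σ i) (autExt Γ F (u m)) =ᵐ[volume] 0 := hu m i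
    have h1 : autExt Γ F (⇑g) =ᵐ[volume] autExt Γ F (fun z => (g - u m) z + (u m) z) := by
      refine autExt_congr_ae hΓ hneg hd hF ?_
      filter_upwards [Lp.coeFn_sub g (u m)] with z hz
      rw [hz]; simp
    have h2 := autExt_add_ae hΓ hneg hd hF (⇑(g - u m)) (⇑(u m))
    have h3 := cuspMeanAt_congr_ae (h1.trans h2) (σ i)
    have hfi := ae_intervalIntegrable_comp_sl_smul_vadd (locallyIntegrable_autExt hΓ hneg hd hF (Lp.memLp (g - u m))) (σ i)
    have hgi := ae_intervalIntegrable_comp_sl_smul_vadd (locallyIntegrable_autExt hΓ hneg hd hF (Lp.memLp (u m))) (σ i)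
    have h4 : Φ =ᵐ[volume] cuspMeanAt (σ i) (autExt Γ F (⇑(g - u m))) := by
      filter_upwards [h3, hfi, hgi, hum] with w hw hfw hgw hu0
      rw [hΦ, hw, cuspMeanAt_add hfw hgw, hu0]
      simp
    calc ∫⁻ w in Metric.closedBall UpperHalfPlane.I n, ‖Φ w‖ₑ
        = ∫⁻ w in Metric.closedBall UpperHalfPlane.I n, ‖cuspMeanAt (σ i) (autExt Γ F (⇑(g - u m))) w‖ₑ := by
          refine lintegral_congr_ae ?_
          filter_upwards [ae_restrict_of_ae h4] with w hw
          rw [hw]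
      _ ≤ K * (∫⁻ w in F, ‖(g - u m) w‖ₑ ^ 2) ^ (1 / 2 : ℝ) := hest _ (Lp.memLp (g - u m)).1
      _ = K * ‖g - u m‖ₑ := by rw [lintegral_rpow_eq_enorm']
  -- the right-hand side tends to `0`
  have htend : Tendsto (fun m => K * ‖g - u m‖ₑ) atTop (𝓝 0) := by
    have h1 : Tendsto (fun m => ‖g - u m‖ₑ) atTop (𝓝 0) := by
      have h2 : Tendsto (fun m => g - u m) atTop (𝓝 0) := by
        have := (tendsto_const_nhds (x := g)).sub hug
        rwa [sub_self] at this
      have h3 := (continuous_enorm.tendsto (0 : Lp ℂ 2 ((volume : Measure ℍ).restrict F))).comp h2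
      rw [enorm_zero] at h3
      exact h3
    have h4 := ENNReal.Tendsto.const_mul h1 (Or.inr hK)
    rwa [mul_zero] at h4
  have hzero : ∫⁻ w in Metric.closedBall UpperHalfPlane.I n, ‖Φ w‖ₑ = 0 :=
    le_antisymm (ge_of_tendsto' htend hbound) bot_le
  rw [lintegral_eq_zero_iff' hΦm.restrict.aemeasurable.enorm] at hzero
  rw [← ae_restrict_iff' measurableSet_closedBall]
  filter_upwards [hzero] with w hw
  simpa using hw

end Closed

/-! ## 4. Invariance under the invariant integral operators; the operators `T_k|_𝓒` -/

section Invariance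

variable {Γ : Subgroup (GL (Fin 2) ℝ)} {F : Set ℍ}
variable (hΓ : Γ ≤ (Matrix.SpecialLinearGroup.toGL : SL(2, ℝ) →* GL (Fin 2) ℝ).range)
  (hneg : (-1 : GL (Fin 2) ℝ) ∈ Γ) (hd : IsDiscreteSubgroup Γ) (hF : IsHypFundamentalDomain Γ F)
  {h : ℕ} (σ : Fin h → SL(2, ℝ)) {k k' : ℝ → ℝ}

/-- **The cuspidal subspace is invariant under `T_k`**: for `g ∈ 𝓒`, `(T_k g)^Γ = L_k g^Γ` a.e. and
`(L_k g^Γ)_𝔞 = L_k((g^Γ)_𝔞) = L_k 0 = 0` at every cusp (Iwaniec §4.2, Proposition: "an invariant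
integral operator `L` maps the subspace `𝓒(Γ\ℍ)` into itself"). [cite: Iwaniec2002, §4.2, PDF p. 49] -/
theorem kernelCLM_mem_cuspSubmodule (hk : IsTestKernel k) (hkc : Continuous k)
    {g : Lp ℂ 2 ((volume : Measure ℍ).restrict F)} (hg : g ∈ cuspSubmodule hΓ hneg hd hF σ) :
    kernelCLM hΓ hneg hd hF hk hkc g ∈ cuspSubmodule hΓ hneg hd hF σ := by
  rw [mem_cuspSubmodule_iff] at hg ⊢
  intro i
  set G : ℍ → ℂ := autExt Γ F g with hG
  have hGl : LocallyIntegrable G := locallyIntegrable_autExt hΓ hneg hd hF (Lp.memLp g)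
  -- `(T_k g)^Γ = L_k G` a.e.
  have h1 : autExt Γ F (⇑(kernelCLM hΓ hneg hd hF hk hkc g)) =ᵐ[volume] autExt Γ F (kernelOp Γ F k g) :=
    autExt_congr_ae hΓ hneg hd hF (kernelCLM_coeFn hΓ hneg hd hF hk hkc g)
  have h2 : autExt Γ F (kernelOp Γ F k g) =ᵐ[volume] kernelOp Γ F k g :=
    autExt_ae_eq_of_isAutomorphic hΓ hneg hd hF (isAutomorphic_kernelOp hΓ hd hk _)
  have h3 : (kernelOp Γ F k g : ℍ → ℂ) =ᵐ[volume] invariantOperator k G :=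
    Eventually.of_forall fun z => kernelOp_eq_invariantOperator hΓ hneg hd hF hk (Lp.memLp g) z
  -- `L_k (G_𝔞) = 0` pointwise since `G_𝔞 = 0` a.e.
  refine (cuspMeanAt_congr_ae ((h1.trans h2).trans h3) (σ i)).trans (Eventually.of_forall fun w => ?_)
  rw [cuspMeanAt_invariantOperator hk hGl (σ i) w]
  exact invariantOperator_of_ae_eq_zero (hg i) w

/-- The cuspidal subspace, being closed in `L²(F)`, is a Hilbert space. [cite: Iwaniec2002, §3.3, PDF p. 44] -/
instance completeSpace_cuspSubmodule : CompleteSpace (cuspSubmodule hΓ hneg hd hF σ) :=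
  (isClosed_cuspSubmodule hΓ hneg hd hF σ).completeSpace_coe

/-- **`T_k` as an operator on the Hilbert space `𝓒`** (the restriction of `T_k` to the invariant
closed subspace of cusp forms). [cite: Iwaniec2002, §4.2–§4.3, PDF pp. 49–52] -/
def cuspKernelCLM (hk : IsTestKernel k) (hkc : Continuous k) :
    cuspSubmodule hΓ hneg hd hF σ →L[ℂ] cuspSubmodule hΓ hneg hd hF σ :=
  ((kernelCLM hΓ hneg hd hF hk hkc).comp (cuspSubmodule hΓ hneg hd hF σ).subtypeL).codRestrict
    (cuspSubmodule hΓ hneg hd hF σ) (fun g => kernelCLM_mem_cuspSubmodule hΓ hneg hd hF σ hk hkc g.2)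

/-- Underlying vectors: `(T_k|_𝓒 g : L²(F)) = T_k g`. [folklore] -/
theorem coe_cuspKernelCLM (hk : IsTestKernel k) (hkc : Continuous k) (g : cuspSubmodule hΓ hneg hd hF σ) :
    ((cuspKernelCLM hΓ hneg hd hF σ hk hkc g : cuspSubmodule hΓ hneg hd hF σ) :
        Lp ℂ 2 ((volume : Measure ℍ).restrict F)) =
      kernelCLM hΓ hneg hd hF hk hkc (g : Lp ℂ 2 ((volume : Measure ℍ).restrict F)) :=
  rfl

/-- `T_k|_𝓒` is symmetric. [cite: Iwaniec2002, §4.1, PDF p. 48] -/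
theorem cuspKernelCLM_isSymmetric (hk : IsTestKernel k) (hkc : Continuous k) :
    (cuspKernelCLM hΓ hneg hd hF σ hk hkc :
      cuspSubmodule hΓ hneg hd hF σ →ₗ[ℂ] cuspSubmodule hΓ hneg hd hF σ).IsSymmetric := by
  intro f g
  rw [Submodule.coe_inner, Submodule.coe_inner]
  exact kernelCLM_isSymmetric hΓ hneg hd hF hk hkc (f : Lp ℂ 2 ((volume : Measure ℍ).restrict F))
    (g : Lp ℂ 2 ((volume : Measure ℍ).restrict F))

/-- **`T_k|_𝓒` is self-adjoint.** [cite: Iwaniec2002, §4.1, PDF p. 48] -/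
theorem isSelfAdjoint_cuspKernelCLM (hk : IsTestKernel k) (hkc : Continuous k) :
    IsSelfAdjoint (cuspKernelCLM hΓ hneg hd hF σ hk hkc) :=
  (cuspKernelCLM_isSymmetric hΓ hneg hd hF σ hk hkc).isSelfAdjoint

/-- **The operators `T_k|_𝓒` commute** (§1.8). [cite: Iwaniec2002, §1.8, PDF pp. 20–21] -/
theorem commute_cuspKernelCLM (hk : IsTestKernel k) (hkc : Continuous k) (hk' : IsTestKernel k')
    (hkc' : Continuous k') :
    Commute (cuspKernelCLM hΓ hneg hd hF σ hk hkc) (cuspKernelCLM hΓ hneg hd hF σ hk' hkc') := by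
  change cuspKernelCLM hΓ hneg hd hF σ hk hkc * cuspKernelCLM hΓ hneg hd hF σ hk' hkc' =
    cuspKernelCLM hΓ hneg hd hF σ hk' hkc' * cuspKernelCLM hΓ hneg hd hF σ hk hkc
  refine ContinuousLinearMap.ext fun g => Subtype.ext ?_
  exact DFunLike.congr_fun (kernelCLM_comp_comm hΓ hneg hd hF hk hkc hk' hkc')
    (g : Lp ℂ 2 ((volume : Measure ℍ).restrict F))

end Invariance

end Fuchsian

end Literature.NumberTheory.Automorphic

end
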